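import Summits.QuantumFields.QCD.Theses.PauliWegnerSea
import Summits.QuantumFields.QCD.Theorems.PauliWegnerSeaTiltedFlatness

/-!
# Stub `stub_fibreBandLaw` of crux `PauliWegnerSea.FMClosureUnquenched` (stmt-QuantumFields-11512) — Aux 1

Line `von-mises-circles`, seat c1 (circle-transport shortcut).  Two self-contained inputs of the
fibre band law:

* `c1_fibreBandLaw_actionLipschitz`: the Wilson action of `SU(3)` lattice gauge theory on `(ℤ/L)^4` is
  `960`-Lipschitz along the one-link circle move `s ↦ U[e ↦ A·T(s)·B]`, `T(s) = diag(e^{is}, e^{-is}, 1)`,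
  for EVERY volume `L ≥ 1` (the landed `CircleTransport.stub_actionLipschitz` states it for `L ≥ 4` only;
  its proof — reproduced here — never used that hypothesis: only the `≤ 80` plaquettes based in the
  shadow of the moved link see it, each plaquette cost moves by `≤ 12 |s - s'|`).
* `c1_fibreBandLaw_normSqTrigPoly`: if `F`, `G` are trigonometric polynomials of degrees `≤ a`, `≤ b`
  (Fourier form `∑_{|k| ≤ a} c_k e^{iks}`), then `(‖F‖ ‖G‖)²` is a trigonometric polynomial of every degree
  `D ≥ 2a + 2b` (Laurent form `e^{-ins} P(e^{is})`, `deg P ≤ 2n`, as in the landed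
  `PauliWegnerSeaTiltedFlatnessStubBandLimit.lean`, whose private closure lemmas are adapted here).

Sources: E. Seiler, LNP 159 (1982) Ch. 1 (locality and smoothness of the Wilson action); folklore.
-/

noncomputable section

namespace Summit.QuantumFields.QCD.Theorems.VonMisesCirclesC1

open scoped BigOperators Real Matrix.Norms.L2Operator
open MeasureTheory Set Filter
open Literature.MathematicalPhysics.QuantumFieldTheory Literature.MathematicalPhysics.QuantumLattice
  Literature.Probability.LatticeModels

/-! ### The Wilson action is Lipschitz along a one-link circle (all volumes) -/

section Lipschitz
-- adapted from `Theorems/PauliWegnerSeaTiltedFlatnessStubActionLipschitz.lean` (private lemmas there)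

/-- `s ↦ e^{is}` is `1`-Lipschitz: `‖e^{ix} - e^{iy}‖ ≤ |x - y|`. -/
private theorem norm_cexp_mul_I_sub_le (x y : ℝ) :
    ‖Complex.exp (x * Complex.I) - Complex.exp (y * Complex.I)‖ ≤ |x - y| := by
  have h : Complex.exp (x * Complex.I) - Complex.exp (y * Complex.I) =
      Complex.exp (y * Complex.I) * (Complex.exp (Complex.I * ((x - y : ℝ) : ℂ)) - 1) := by
    rw [mul_sub, mul_one, ← Complex.exp_add]
    congr 1
    push_cast
    ring_nf
  rw [h, norm_mul, Complex.norm_exp_ofReal_mul_I, one_mul]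
  exact (Real.norm_exp_I_mul_ofReal_sub_one_le).trans (le_of_eq (Real.norm_eq_abs _))

/-- The diagonal circle `T(s) = diag(e^{is}, e^{-is}, 1)` is `1`-Lipschitz in the `L²` operator
norm: `‖T(s) - T(s')‖ ≤ |s - s'|`. -/
private theorem norm_circle_sub_le (T : ℝ → Matrix.specialUnitaryGroup (Fin 3) ℂ)
    (hT : ∀ θ : ℝ, ((T θ : Matrix.specialUnitaryGroup (Fin 3) ℂ) : Matrix (Fin 3) (Fin 3) ℂ) =
      Matrix.diagonal ![Complex.exp (θ * Complex.I), Complex.exp (-(θ * Complex.I)), 1])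
    (s s' : ℝ) :
    ‖((T s : Matrix.specialUnitaryGroup (Fin 3) ℂ) : Matrix (Fin 3) (Fin 3) ℂ) -
        (T s' : Matrix.specialUnitaryGroup (Fin 3) ℂ)‖ ≤ |s - s'| := by
  rw [hT, hT, Matrix.diagonal_sub, Matrix.l2_opNorm_diagonal]
  refine (pi_norm_le_iff_of_nonneg (abs_nonneg _)).2 fun k => ?_
  fin_cases k
  · simpa using norm_cexp_mul_I_sub_le s s'
  · have h := norm_cexp_mul_I_sub_le (-s) (-s')
    rw [show -s - -s' = -(s - s') by ring, abs_neg] at h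
    simpa using h
  · simp

/-- Entries of a `3 × 3` complex matrix are bounded by its `L²` operator norm. -/
private theorem norm_entry_le_l2op (M : Matrix (Fin 3) (Fin 3) ℂ) (a b : Fin 3) :
    ‖M a b‖ ≤ ‖M‖ := by
  have h := Matrix.l2_opNorm_mulVec M (EuclideanSpace.single b (1 : ℂ))
  rw [PiLp.norm_single, norm_one, mul_one] at h
  refine le_trans ?_ h
  have h2 := PiLp.norm_apply_le
    ((EuclideanSpace.equiv (Fin 3) ℂ).symm (M.mulVec (EuclideanSpace.single b (1 : ℂ)))) a
  have h3 : ((EuclideanSpace.equiv (Fin 3) ℂ).symm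
      (M.mulVec (EuclideanSpace.single b (1 : ℂ)))) a = M a b := by
    rw [PiLp.coe_symm_continuousLinearEquiv, PiLp.toLp_apply, PiLp.ofLp_single,
      Matrix.mulVec_single_one]
    rfl
  rw [h3] at h2
  exact h2

/-- `|Re tr M - Re tr M'| ≤ 3 ‖M - M'‖` for `3 × 3` complex matrices in the `L²` operator norm. -/
private theorem abs_re_trace_sub_le (M M' : Matrix (Fin 3) (Fin 3) ℂ) :
    |M.trace.re - M'.trace.re| ≤ 3 * ‖M - M'‖ := by
  rw [← Complex.sub_re, ← Matrix.trace_sub]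
  refine (Complex.abs_re_le_norm _).trans ?_
  rw [Matrix.trace, Fin.sum_univ_three, Matrix.diag_apply, Matrix.diag_apply, Matrix.diag_apply]
  refine (norm_add₃_le).trans ?_
  have h0 := norm_entry_le_l2op (M - M') 0 0
  have h1 := norm_entry_le_l2op (M - M') 1 1
  have h2 := norm_entry_le_l2op (M - M') 2 2
  linarith

/-- In a C⋆-ring, a telescoping bound for the difference of two fourfold products whose factors
are unitary: `‖abcd - a'b'c'd'‖ ≤ ‖a - a'‖ + ‖b - b'‖ + ‖c - c'‖ + ‖d - d'‖`. -/
private theorem norm_mul₄_sub_mul₄_le {E : Type*} [NormedRing E] [StarRing E] [CStarRing E]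
    {a b c d a' b' c' d' : E} (hb : b ∈ unitary E) (hc : c ∈ unitary E) (hd : d ∈ unitary E)
    (ha' : a' ∈ unitary E) (hb' : b' ∈ unitary E) (hc' : c' ∈ unitary E) :
    ‖a * b * c * d - a' * b' * c' * d'‖ ≤ ‖a - a'‖ + ‖b - b'‖ + ‖c - c'‖ + ‖d - d'‖ := by
  have h : a * b * c * d - a' * b' * c' * d' = (a - a') * b * c * d + a' * (b - b') * c * d +
      a' * b' * (c - c') * d + a' * b' * c' * (d - d') := by noncomm_ring
  have h1 : ‖(a - a') * b * c * d‖ = ‖a - a'‖ := by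
    rw [CStarRing.norm_mul_mem_unitary _ hd, CStarRing.norm_mul_mem_unitary _ hc,
      CStarRing.norm_mul_mem_unitary _ hb]
  have h2 : ‖a' * (b - b') * c * d‖ = ‖b - b'‖ := by
    rw [CStarRing.norm_mul_mem_unitary _ hd, CStarRing.norm_mul_mem_unitary _ hc,
      CStarRing.norm_mem_unitary_mul _ ha']
  have h3 : ‖a' * b' * (c - c') * d‖ = ‖c - c'‖ := by
    rw [CStarRing.norm_mul_mem_unitary _ hd, CStarRing.norm_mem_unitary_mul _ (mul_mem ha' hb')]
  have h4 : ‖a' * b' * c' * (d - d')‖ = ‖d - d'‖ := by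
    rw [CStarRing.norm_mem_unitary_mul _ (mul_mem (mul_mem ha' hb') hc')]
  rw [h]
  refine (norm_add_le _ _).trans ?_
  rw [h4]
  refine add_le_add ((norm_add₃_le).trans ?_) le_rfl
  rw [h1, h2, h3]

/-- Replacing the variable `g` on one link `e` by `g'` moves (the fundamental representation of)
every plaquette holonomy by at most `4 ‖g - g'‖` in the `L²` operator norm. -/
private theorem norm_holonomy_update_sub_le {L : ℕ}
    (U : GaugeConfig 4 L (Matrix.specialUnitaryGroup (Fin 3) ℂ)) (e : Edge 4 L)
    (g g' : Matrix.specialUnitaryGroup (Fin 3) ℂ) (x : Site 4 L) (i j : Fin 4) :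
    ‖(fundamentalRep (Fin 3)) (plaquetteHolonomy (Function.update U e g) x i j) -
        (fundamentalRep (Fin 3)) (plaquetteHolonomy (Function.update U e g') x i j)‖ ≤
      4 * ‖(g : Matrix (Fin 3) (Fin 3) ℂ) - (g' : Matrix.specialUnitaryGroup (Fin 3) ℂ)‖ := by
  have hmem : ∀ W : Matrix.specialUnitaryGroup (Fin 3) ℂ,
      (W : Matrix (Fin 3) (Fin 3) ℂ) ∈ unitary (Matrix (Fin 3) (Fin 3) ℂ) :=
    fun W => W.2.1
  have hlink : ∀ e' : Edge 4 L,
      ‖((Function.update U e g e' : Matrix.specialUnitaryGroup (Fin 3) ℂ) : Matrix (Fin 3) (Fin 3) ℂ) -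
          (Function.update U e g' e' : Matrix.specialUnitaryGroup (Fin 3) ℂ)‖ ≤
        ‖(g : Matrix (Fin 3) (Fin 3) ℂ) - (g' : Matrix.specialUnitaryGroup (Fin 3) ℂ)‖ := by
    intro e'
    by_cases h : e' = e
    · subst h
      rw [Function.update_self, Function.update_self]
    · rw [Function.update_of_ne h, Function.update_of_ne h, sub_self, norm_zero]
      exact norm_nonneg _
  simp only [fundamentalRep_apply, plaquetteHolonomy, Submonoid.coe_mul, ← Matrix.star_eq_inv,
    Matrix.specialUnitaryGroup.coe_star]
  refine (norm_mul₄_sub_mul₄_le (hmem _) (Unitary.star_mem (hmem _)) (Unitary.star_mem (hmem _))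
    (hmem _) (hmem _) (Unitary.star_mem (hmem _))).trans ?_
  rw [← star_sub, norm_star, ← star_sub, norm_star]
  linarith [hlink (x, i), hlink (x.shift i, j), hlink (x.shift j, i), hlink (x, j)]

/-- At most `80` plaquettes of the torus `(ℤ/L)^4` are based in the shadow of one link. -/
private theorem card_shadow_plaquettes_le {L : ℕ} [NeZero L] (e : Edge 4 L) :
    (Finset.univ.filter fun p : Plaquette 4 L => p.1 ∈ edgeShadow {e}).card ≤ 80 := by
  have hset : Finset.univ.filter (fun p : Plaquette 4 L => p.1 ∈ edgeShadow {e}) =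
      edgeShadow {e} ×ˢ Finset.univ := by
    ext p; simp
  rw [hset, Finset.card_product, Finset.card_univ]
  have h1 : (edgeShadow ({e} : Finset (Edge 4 L))).card ≤ 5 := by
    simpa using card_edgeShadow_le ({e} : Finset (Edge 4 L))
  have h2 : Fintype.card {q : Fin 4 × Fin 4 // q.1 < q.2} ≤ 16 :=
    (Fintype.card_subtype_le _).trans (by simp)
  calc _ ≤ 5 * 16 := Nat.mul_le_mul h1 h2
    _ = 80 := by norm_num

/-- **The Wilson action is `960`-Lipschitz along the one-link circle, in every volume `L ≥ 1`.**
`|S_W(U[e ↦ A T(s) B]) - S_W(U[e ↦ A T(s') B])| ≤ K |s - s'|` uniformly in `L`, `U`, `e`, `A`, `B`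
(same proof as the landed `CircleTransport.stub_actionLipschitz`, which carries an unused `4 ≤ L`). -/
theorem c1_fibreBandLaw_actionLipschitz : ∀ T : ℝ → Matrix.specialUnitaryGroup (Fin 3) ℂ,
    (∀ θ : ℝ, ((T θ : Matrix.specialUnitaryGroup (Fin 3) ℂ) : Matrix (Fin 3) (Fin 3) ℂ) =
      Matrix.diagonal ![Complex.exp (θ * Complex.I), Complex.exp (-(θ * Complex.I)), 1]) →
    ∃ K : ℝ, 0 ≤ K ∧ ∀ (L : ℕ) [NeZero L]
      (U : GaugeConfig 4 L (Matrix.specialUnitaryGroup (Fin 3) ℂ)) (e : Edge 4 L)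
      (A B : Matrix.specialUnitaryGroup (Fin 3) ℂ) (s s' : ℝ),
      |wilsonAction (fundamentalRep (Fin 3)) (Function.update U e (A * T s * B)) -
          wilsonAction (fundamentalRep (Fin 3)) (Function.update U e (A * T s' * B))| ≤ K * |s - s'| := by
  intro T hT
  refine ⟨960, by norm_num, fun L _ U e A B s s' => ?_⟩
  set ρ : Matrix.specialUnitaryGroup (Fin 3) ℂ →* Matrix (Fin 3) (Fin 3) ℂ := fundamentalRep (Fin 3)
    with hρ
  set V : GaugeConfig 4 L (Matrix.specialUnitaryGroup (Fin 3) ℂ) := Function.update U e (A * T s * B)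
    with hV
  set V' : GaugeConfig 4 L (Matrix.specialUnitaryGroup (Fin 3) ℂ) := Function.update U e (A * T s' * B)
    with hV'
  -- the moved link: `‖g - g'‖ ≤ |s - s'|`
  have hg : ‖((A * T s * B : Matrix.specialUnitaryGroup (Fin 3) ℂ) : Matrix (Fin 3) (Fin 3) ℂ) -
      (A * T s' * B : Matrix.specialUnitaryGroup (Fin 3) ℂ)‖ ≤ |s - s'| := by
    have hmul : ((A * T s * B : Matrix.specialUnitaryGroup (Fin 3) ℂ) : Matrix (Fin 3) (Fin 3) ℂ) -
        (A * T s' * B : Matrix.specialUnitaryGroup (Fin 3) ℂ) =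
        (A : Matrix (Fin 3) (Fin 3) ℂ) * ((T s : Matrix.specialUnitaryGroup (Fin 3) ℂ) -
          (T s' : Matrix.specialUnitaryGroup (Fin 3) ℂ) : Matrix (Fin 3) (Fin 3) ℂ) *
          (B : Matrix (Fin 3) (Fin 3) ℂ) := by
      simp only [Submonoid.coe_mul]
      noncomm_ring
    rw [hmul, CStarRing.norm_mul_mem_unitary _ B.2.1, CStarRing.norm_mem_unitary_mul _ A.2.1]
    exact norm_circle_sub_le T hT s s'
  -- per-plaquette bound
  have hper : ∀ p : Plaquette 4 L,
      |plaquetteCost ρ V p - plaquetteCost ρ V' p| ≤ 12 * |s - s'| := by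
    intro p
    unfold plaquetteCost
    rw [sub_sub_sub_cancel_left]
    refine (abs_re_trace_sub_le _ _).trans ?_
    have h := norm_holonomy_update_sub_le U e (A * T s' * B) (A * T s * B) p.1 p.2.1.1 p.2.1.2
    rw [← norm_neg, neg_sub] at hg
    linarith
  -- only the shadow plaquettes differ
  have hVV' : ∀ e' ∉ ({e} : Finset (Edge 4 L)), V e' = V' e' := by
    intro e' he'
    rw [Finset.mem_singleton] at he'
    simp only [hV, hV', Function.update_of_ne he']
  rw [wilsonAction_eq_shadowAction_add_bulkAction ρ (edgeShadow {e}) V,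
    wilsonAction_eq_shadowAction_add_bulkAction ρ (edgeShadow {e}) V', bulkAction_congr ρ hVV',
    add_sub_add_right_eq_sub]
  unfold shadowAction
  rw [← Finset.sum_sub_distrib]
  refine (Finset.abs_sum_le_sum_abs _ _).trans ?_
  refine (Finset.sum_le_sum fun p _ => hper p).trans ?_
  rw [Finset.sum_const, nsmul_eq_mul]
  have hcard :
      ((Finset.univ.filter fun p : Plaquette 4 L => p.1 ∈ edgeShadow {e}).card : ℝ) ≤ 80 := by
    exact_mod_cast card_shadow_plaquettes_le e
  nlinarith [abs_nonneg (s - s')]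

end Lipschitz

/-! ### `(‖F‖ ‖G‖)²` is band-limited when `F`, `G` are -/

section TrigPoly
-- Laurent form `F(s) = e^{-ins} P(e^{is})`, `deg P ≤ 2n`; closure lemmas adapted from
-- `Theorems/PauliWegnerSeaTiltedFlatnessStubBandLimit.lean` (private there)

open Polynomial Complex

/-- Closure under left scalar multiplication. -/
private theorem tp_smul {n : ℕ} (c : ℂ) {F : ℝ → ℂ}
    (hF : ∃ P : ℂ[X], P.natDegree ≤ 2 * n ∧ ∀ s : ℝ,
      F s = exp (-((n : ℂ) * s * I)) * P.eval (exp (s * I))) :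
    ∃ P : ℂ[X], P.natDegree ≤ 2 * n ∧ ∀ s : ℝ,
      c * F s = exp (-((n : ℂ) * s * I)) * P.eval (exp (s * I)) := by
  obtain ⟨P, hP, hF⟩ := hF
  exact ⟨Polynomial.C c * P, (natDegree_C_mul_le _ _).trans hP, fun s => by
    rw [hF s, eval_mul, eval_C]; ring⟩

/-- Closure under finite sums. -/
private theorem tp_sum {α : Type*} {n : ℕ} (S : Finset α) {F : α → ℝ → ℂ}
    (hF : ∀ i ∈ S, ∃ P : ℂ[X], P.natDegree ≤ 2 * n ∧ ∀ s : ℝ,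
      F i s = exp (-((n : ℂ) * s * I)) * P.eval (exp (s * I))) :
    ∃ P : ℂ[X], P.natDegree ≤ 2 * n ∧ ∀ s : ℝ,
      ∑ i ∈ S, F i s = exp (-((n : ℂ) * s * I)) * P.eval (exp (s * I)) := by
  classical
  induction S using Finset.induction_on with
  | empty => exact ⟨0, by simp, fun s => by simp⟩
  | insert a S ha ih =>
    obtain ⟨P, hP, hFa⟩ := hF a (Finset.mem_insert_self a S)
    obtain ⟨Q, hQ, hG⟩ := ih fun i hi => hF i (Finset.mem_insert_of_mem hi)
    exact ⟨P + Q, (natDegree_add_le _ _).trans (max_le hP hQ), fun s => by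
      rw [Finset.sum_insert ha, hFa s, hG s, eval_add, mul_add]⟩

/-- Degrees add under products (`P · Q`). -/
private theorem tp_mul {a b : ℕ} {F G : ℝ → ℂ}
    (hF : ∃ P : ℂ[X], P.natDegree ≤ 2 * a ∧ ∀ s : ℝ,
      F s = exp (-((a : ℂ) * s * I)) * P.eval (exp (s * I)))
    (hG : ∃ P : ℂ[X], P.natDegree ≤ 2 * b ∧ ∀ s : ℝ,
      G s = exp (-((b : ℂ) * s * I)) * P.eval (exp (s * I))) :
    ∃ P : ℂ[X], P.natDegree ≤ 2 * (a + b) ∧ ∀ s : ℝ,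
      F s * G s = exp (-(((a + b : ℕ) : ℂ) * s * I)) * P.eval (exp (s * I)) := by
  obtain ⟨P, hP, hF⟩ := hF
  obtain ⟨Q, hQ, hG⟩ := hG
  refine ⟨P * Q, natDegree_mul_le.trans (by omega), fun s => ?_⟩
  rw [hF s, hG s, eval_mul, Nat.cast_add,
    show -((a + b : ℂ) * s * I) = -(a * s * I) + -(b * s * I) by ring, Complex.exp_add]
  ring

/-- Monotonicity in the degree (`P ↦ P X^{m-n}`). -/
private theorem tp_mono {n m : ℕ} (h : n ≤ m) {F : ℝ → ℂ}
    (hF : ∃ P : ℂ[X], P.natDegree ≤ 2 * n ∧ ∀ s : ℝ,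
      F s = exp (-((n : ℂ) * s * I)) * P.eval (exp (s * I))) :
    ∃ P : ℂ[X], P.natDegree ≤ 2 * m ∧ ∀ s : ℝ,
      F s = exp (-((m : ℂ) * s * I)) * P.eval (exp (s * I)) := by
  obtain ⟨P, hP, hF⟩ := hF
  refine ⟨P * X ^ (m - n),
    natDegree_mul_le.trans ((add_le_add hP (natDegree_X_pow_le _)).trans (by omega)),
    fun s => ?_⟩
  rw [hF s, eval_mul, eval_pow, eval_X, ← Complex.exp_nat_mul, Nat.cast_sub h,
    mul_comm (P.eval _) _, ← mul_assoc, ← Complex.exp_add]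
  congr 2; ring

/-- From the Laurent to the Fourier form: `e^{-ins} P(e^{is}) = ∑_{|k| ≤ n} P_{k+n} e^{iks}`. -/
private theorem tp_fourier {n : ℕ} {F : ℝ → ℂ}
    (hF : ∃ P : ℂ[X], P.natDegree ≤ 2 * n ∧ ∀ s : ℝ,
      F s = exp (-((n : ℂ) * s * I)) * P.eval (exp (s * I))) :
    ∃ a : ℤ → ℂ, ∀ s : ℝ,
      F s = ∑ k ∈ Finset.Icc (-(n : ℤ)) (n : ℤ), a k * exp ((k : ℂ) * (s : ℂ) * I) := by
  obtain ⟨P, hP, hF⟩ := hF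
  refine ⟨fun k => P.coeff (k + n).toNat, fun s => ?_⟩
  rw [hF s, eval_eq_sum_range' (Nat.lt_succ_of_le hP), Int.Icc_eq_finset_map, Finset.sum_map,
    Finset.mul_sum, show ((n : ℤ) + 1 - -(n : ℤ)).toNat = 2 * n + 1 by omega]
  refine Finset.sum_congr rfl fun j _ => ?_
  simp only [Function.Embedding.trans_apply, Nat.castEmbedding_apply, addLeftEmbedding_apply]
  rw [show (-(n : ℤ) + j + n).toNat = j by omega, ← Complex.exp_nat_mul, mul_left_comm,
    ← Complex.exp_add]
  congr 2; push_cast; ring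

/-- The characters `e^{iks}`, `|k| ≤ n`, have degree `n` (`P = X^{k+n}`). -/
private theorem tp_exp_int (n : ℕ) (k : ℤ) (hk : k ∈ Finset.Icc (-(n : ℤ)) n) :
    ∃ P : ℂ[X], P.natDegree ≤ 2 * n ∧ ∀ s : ℝ,
      exp ((k : ℂ) * (s : ℂ) * I) = exp (-((n : ℂ) * s * I)) * P.eval (exp (s * I)) := by
  rw [Finset.mem_Icc] at hk
  refine ⟨X ^ (k + n).toNat, (natDegree_X_pow_le _).trans (by omega), fun s => ?_⟩
  rw [eval_pow, eval_X, ← Complex.exp_nat_mul, ← Complex.exp_add]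
  have h : (((k + n).toNat : ℕ) : ℂ) = ((k + n : ℤ) : ℂ) := by
    rw [show (((k + n).toNat : ℕ) : ℂ) = ((((k + n).toNat : ℕ) : ℤ) : ℂ) by push_cast; rfl,
      Int.toNat_of_nonneg (by omega)]
  rw [h]; congr 1; push_cast; ring

/-- From the Fourier to the Laurent form. -/
private theorem tp_of_fourier {n : ℕ} {F : ℝ → ℂ}
    (hF : ∃ a : ℤ → ℂ, ∀ s : ℝ,
      F s = ∑ k ∈ Finset.Icc (-(n : ℤ)) (n : ℤ), a k * exp ((k : ℂ) * (s : ℂ) * I)) :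
    ∃ P : ℂ[X], P.natDegree ≤ 2 * n ∧ ∀ s : ℝ,
      F s = exp (-((n : ℂ) * s * I)) * P.eval (exp (s * I)) := by
  obtain ⟨a, ha⟩ := hF
  obtain ⟨P, hP, h⟩ := tp_sum (Finset.Icc (-(n : ℤ)) (n : ℤ))
    (F := fun k s => a k * exp ((k : ℂ) * (s : ℂ) * I))
    fun k hk => tp_smul (a k) (tp_exp_int n k hk)
  exact ⟨P, hP, fun s => by rw [ha s]; exact h s⟩

/-- The conjugate of a Fourier-form trigonometric polynomial, in Laurent form (same degree). -/
private theorem tp_conj_of_fourier {n : ℕ} {F : ℝ → ℂ}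
    (hF : ∃ a : ℤ → ℂ, ∀ s : ℝ,
      F s = ∑ k ∈ Finset.Icc (-(n : ℤ)) (n : ℤ), a k * exp ((k : ℂ) * (s : ℂ) * I)) :
    ∃ P : ℂ[X], P.natDegree ≤ 2 * n ∧ ∀ s : ℝ,
      (starRingEnd ℂ) (F s) = exp (-((n : ℂ) * s * I)) * P.eval (exp (s * I)) := by
  obtain ⟨a, ha⟩ := hF
  have hterm : ∀ k ∈ Finset.Icc (-(n : ℤ)) (n : ℤ), ∃ P : ℂ[X], P.natDegree ≤ 2 * n ∧ ∀ s : ℝ,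
      (starRingEnd ℂ) (a k * exp ((k : ℂ) * (s : ℂ) * I)) =
        exp (-((n : ℂ) * s * I)) * P.eval (exp (s * I)) := by
    intro k hk
    have hk' : -k ∈ Finset.Icc (-(n : ℤ)) (n : ℤ) := by
      rw [Finset.mem_Icc] at hk ⊢; omega
    obtain ⟨P, hP, h⟩ := tp_smul ((starRingEnd ℂ) (a k)) (tp_exp_int n (-k) hk')
    refine ⟨P, hP, fun s => ?_⟩
    rw [← h s, map_mul, ← Complex.exp_conj, map_mul, map_mul, Complex.conj_ofReal, Complex.conj_I,
      map_intCast]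
    congr 2; push_cast; ring
  obtain ⟨P, hP, h⟩ := tp_sum _ hterm
  exact ⟨P, hP, fun s => by rw [ha s, map_sum]; exact h s⟩

/-- **`(‖F‖ ‖G‖)²` is band-limited.**  If `F` and `G` are trigonometric polynomials of degrees `≤ a`
and `≤ b`, then `s ↦ (‖F s‖ ‖G s‖)²` is a (real-valued) trigonometric polynomial of every degree
`D ≥ 2a + 2b`. -/
theorem c1_fibreBandLaw_normSqTrigPoly {a b D : ℕ} (hD : 2 * a + 2 * b ≤ D) {F G : ℝ → ℂ}
    (hF : ∃ c : ℤ → ℂ, ∀ s : ℝ,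
      F s = ∑ k ∈ Finset.Icc (-(a : ℤ)) a, c k * Complex.exp ((k : ℂ) * (s : ℂ) * Complex.I))
    (hG : ∃ c : ℤ → ℂ, ∀ s : ℝ,
      G s = ∑ k ∈ Finset.Icc (-(b : ℤ)) b, c k * Complex.exp ((k : ℂ) * (s : ℂ) * Complex.I)) :
    ∃ c : ℤ → ℂ, ∀ s : ℝ, (((‖F s‖ * ‖G s‖) ^ 2 : ℝ) : ℂ) =
      ∑ k ∈ Finset.Icc (-(D : ℤ)) D, c k * Complex.exp ((k : ℂ) * (s : ℂ) * Complex.I) := by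
  have hFF := tp_mul (tp_of_fourier hF) (tp_conj_of_fourier hF)
  have hGG := tp_mul (tp_of_fourier hG) (tp_conj_of_fourier hG)
  have h4 := tp_mono (show a + a + (b + b) ≤ D by omega) (tp_mul hFF hGG)
  obtain ⟨c, hc⟩ := tp_fourier h4
  refine ⟨c, fun s => ?_⟩
  rw [← hc s, Complex.mul_conj', Complex.mul_conj']
  push_cast; ring

end TrigPoly

end Summit.QuantumFields.QCD.Theorems.VonMisesCirclesC1
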